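import Literature.Probability.Percolation.LongRangeGoodBlocks
import HarnessLib

/-!
# Long-range bond percolation on `ℤ`: chains of good blocks and the covering lemma

Topic `Literature/Probability/Percolation`; deterministic companion of `LongRangeGoodBlocks.lean`
(Duminil-Copin–Garban–Tassion, *Long-range models in 1D revisited*, AIHP 60 (2024),
arXiv:2011.04642, §2.3, proof of Lemma 2).

## Contents (all proved, configuration-wise)

* `goodWitness K θ i ω` — a chosen site of `B^i_K` with block cluster of size `≥ 2θK` (when the
  block is `θ`-good), depending on `ω` only through the edges inside the block;
* `chainEdges K a b`, `chainSites K a b`, `chainCluster K θ a b ω` — the edges inside the blocks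
  `B^j_K`, `a ≤ j ≤ b`, their sites `[K(a-1), K(b+1))`, and the merged cluster of the chain
  (DGT's `𝐂⁻`, `𝐂⁺`, here the full cluster of the witness of `B^a_K` through chain edges), its
  locality, its containment of every block cluster of the chain, the size bound `N · 2θK ≤ #`;
* `good_mul_of_good_chain` — `N` pairwise disjoint good `K`-blocks inside `B_{CK}` make
  `B_{CK}` `θ'`-good as soon as `2θ'CK ≤ N·2θK`;
* `twoBad K θ C` ("two disjoint `θ`-bad `K`-blocks"), `isolBad K θ C i` (DGT's `E_i`), the
  **covering lemma** `bad_mul_subset`: `{B_{CK} (θ - C₀/C)-bad} ⊆ twoBad ∪ ⋃_{|i| ≤ C - C₀}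
  (isolBad i ∩ {B_{CK} bad})` ("either there exist (at least) two disjoint `θ`-bad `K`-blocks, or
  there exists `i` such that `F_i` occurs", and "`F_i = ∅` whenever `|i| > C - C₀`"), and
  `forall_not_mem_of_isolBad` — on `F_i` no open edge joins `𝐂⁻` to `𝐂⁺`;
* locality: `determinedBy_isolBad`, `chainCluster_pair_inter_eq`, `DeterminedBy.inter_preimage_singleton`.

Reference: H. Duminil-Copin, C. Garban, V. Tassion, *Long-range models in 1D revisited*,
AIHP 60 (2024) 232–241, arXiv:2011.04642: §2.3 (Lemma 2 and its proof).
-/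

noncomputable section

open scoped Classical

namespace Literature.Probability.Percolation

open SimpleGraph Finset

/-! ### Witnesses of good blocks -/

/-- Choice of a site with a big cluster, as a function of the cluster map `c` (so that the
dependence on the configuration is visibly through the block clusters only). [folklore] -/
def bigSite (K : ℕ) (θ : ℝ) (i : ℤ) (c : ℤ → Finset ℤ) : ℤ :=
  if h : ∃ x ∈ blk K i, 2 * θ * K ≤ ((c x).card : ℝ) then h.choose else (K : ℤ) * (i - 1)

/-- **Witness of a good block**: a site of `B^i_K` whose cluster in the block has `≥ 2θK`
vertices (DGT's `𝐂(B^i_K)`, "the largest cluster in `B^i_K`", is the cluster of this site when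
`θ > 3/4`); a junk site of the block otherwise. [cite: DuminilcopinGarbanTassion2024, §2.3 (𝐂(B^i_K))] -/
def goodWitness (K : ℕ) (θ : ℝ) (i : ℤ) (ω : BondConfig ℤ) : ℤ :=
  bigSite K θ i fun x => blkCluster ω K i x

/-- On a good block the witness lies in the block and has a big block cluster. [folklore] -/
theorem goodWitness_spec {K : ℕ} {θ : ℝ} {i : ℤ} {ω : BondConfig ℤ} (h : ω ∈ good K θ i) :
    goodWitness K θ i ω ∈ blk K i ∧
      2 * θ * K ≤ ((blkCluster ω K i (goodWitness K θ i ω)).card : ℝ) := by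
  have h' : ∃ x ∈ blk K i, 2 * θ * K ≤ ((blkCluster ω K i x).card : ℝ) := h
  simp only [goodWitness, bigSite, dif_pos h']
  exact h'.choose_spec

/-- The witness only depends on the edges inside the block. [folklore] -/
theorem goodWitness_inter_eq {K : ℕ} {θ : ℝ} {i : ℤ} {F : Set (Sym2 ℤ)} (hF : blkEdges K i ⊆ F)
    (ω : BondConfig ℤ) : goodWitness K θ i (ω ∩ F) = goodWitness K θ i ω := by
  unfold goodWitness
  congr 1
  funext x
  exact locCluster_inter_eq hF _ _

/-! ### Chains of blocks -/

/-- The edges inside the blocks `B^j_K`, `a ≤ j ≤ b`. [cite: DuminilcopinGarbanTassion2024, §2.3] -/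
def chainEdges (K : ℕ) (a b : ℤ) : Set (Sym2 ℤ) := {e | ∃ j, a ≤ j ∧ j ≤ b ∧ e ∈ blkEdges K j}

/-- The sites `[K(a-1), K(b+1))` of the blocks `B^j_K`, `a ≤ j ≤ b`. [folklore] -/
def chainSites (K : ℕ) (a b : ℤ) : Finset ℤ := Finset.Ico ((K : ℤ) * (a - 1)) ((K : ℤ) * (b + 1))

/-- Each block edge set of the chain lies in `chainEdges`. [folklore] -/
theorem blkEdges_subset_chainEdges {K : ℕ} {a b j : ℤ} (haj : a ≤ j) (hjb : j ≤ b) :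
    blkEdges K j ⊆ chainEdges K a b := fun _ he => ⟨j, haj, hjb, he⟩

/-- Each block of the chain lies in `chainSites`. [folklore] -/
theorem blk_subset_chainSites {K : ℕ} {a b j : ℤ} (haj : a ≤ j) (hjb : j ≤ b) :
    blk K j ⊆ chainSites K a b := by
  intro x hx
  rw [mem_blk] at hx
  rw [chainSites, Finset.mem_Ico]
  constructor <;> nlinarith [hx.1, hx.2, Int.natCast_nonneg K]

/-- Chain edges have both endpoints among the chain sites. [folklore] -/
theorem chainEdges_subset_sym2 (K : ℕ) (a b : ℤ) :
    chainEdges K a b ⊆ ↑(chainSites K a b).sym2 := by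
  rintro e ⟨j, haj, hjb, he⟩
  exact Finset.sym2_mono (blk_subset_chainSites haj hjb) he

/-- Chain edges are monotone in the index interval. [folklore] -/
theorem chainEdges_mono {K : ℕ} {a b a' b' : ℤ} (ha : a' ≤ a) (hb : b ≤ b') :
    chainEdges K a b ⊆ chainEdges K a' b' := by
  rintro e ⟨j, haj, hjb, he⟩
  exact ⟨j, by linarith, by linarith, he⟩

/-- The chain edges of blocks inside `B_{CK}` are edges inside `B_{CK}`. [folklore] -/
theorem chainEdges_subset_blkEdges_mul {K C : ℕ} {a b : ℤ} (ha : -(C : ℤ) + 1 ≤ a) (hb : b ≤ (C : ℤ) - 1) :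
    chainEdges K a b ⊆ blkEdges (C * K) 0 := by
  rintro e ⟨j, haj, hjb, he⟩
  exact Finset.sym2_mono (blk_subset_blk_mul (by linarith) (by linarith)) he

/-- The sites of a chain of blocks inside `B_{CK}` are sites of `B_{CK}`. [folklore] -/
theorem chainSites_subset_blk_mul {K C : ℕ} {a b : ℤ} (ha : -(C : ℤ) + 1 ≤ a) (hb : b ≤ (C : ℤ) - 1) :
    chainSites K a b ⊆ blk (C * K) 0 := by
  intro x hx
  rw [chainSites, Finset.mem_Ico] at hx
  rw [mem_blk]
  push_cast
  constructor <;> nlinarith [hx.1, hx.2, Int.natCast_nonneg K]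

/-- The chain edge set is finite. [folklore] -/
theorem chainEdges_finite (K : ℕ) (a b : ℤ) : (chainEdges K a b).Finite :=
  (chainSites K a b).sym2.finite_toSet.subset (chainEdges_subset_sym2 K a b)

/-- **The merged cluster of a chain** (`𝐂⁻`, `𝐂⁺` of DGT): the cluster of the witness of `B^a_K`
among the chain sites, through open chain edges.
[cite: DuminilcopinGarbanTassion2024, §2.3 (proof of Lemma 2, 𝐂⁻ and 𝐂⁺)] -/
def chainCluster (K : ℕ) (θ : ℝ) (a b : ℤ) (ω : BondConfig ℤ) : Finset ℤ :=
  locCluster ω (chainEdges K a b) (chainSites K a b) (goodWitness K θ a ω)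

/-- The merged cluster lies among the chain sites. [folklore] -/
theorem chainCluster_subset (K : ℕ) (θ : ℝ) (a b : ℤ) (ω : BondConfig ℤ) :
    chainCluster K θ a b ω ⊆ chainSites K a b :=
  locCluster_subset ω _ _ _

/-- The merged cluster only depends on the chain edges ("the definition of `𝐂⁻` and `𝐂⁺`
involves only edges with endpoints within a distance `2K` of each other").
[cite: DuminilcopinGarbanTassion2024, §2.3 (proof of Lemma 2)] -/
theorem chainCluster_inter_eq {K : ℕ} {θ : ℝ} {a b : ℤ} (hab : a ≤ b) {F : Set (Sym2 ℤ)}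
    (hF : chainEdges K a b ⊆ F) (ω : BondConfig ℤ) :
    chainCluster K θ a b (ω ∩ F) = chainCluster K θ a b ω := by
  unfold chainCluster
  rw [goodWitness_inter_eq ((blkEdges_subset_chainEdges le_rfl hab).trans hF),
    locCluster_inter_eq hF]

/-- Every vertex of the merged cluster is joined to the witness of `B^a_K` by open chain edges.
[folklore] -/
theorem reachable_of_mem_chainCluster {K : ℕ} {θ : ℝ} {a b : ℤ} {ω : BondConfig ℤ} {u : ℤ}
    (hu : u ∈ chainCluster K θ a b ω) :
    (openGraph (ω ∩ chainEdges K a b)).Reachable (goodWitness K θ a ω) u :=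
  (mem_locCluster.1 hu).2

/-- **Along a chain of good blocks the merged cluster contains every block cluster.**
[cite: DuminilcopinGarbanTassion2024, §2.3 (proof of Lemma 2)] -/
theorem blkCluster_subset_chainCluster {K : ℕ} (hK : 1 ≤ K) {θ : ℝ} (hθ : 3 / 4 < θ)
    {a b : ℤ} {ω : BondConfig ℤ} (hgood : ∀ j, a ≤ j → j ≤ b → ω ∈ good K θ j)
    {j : ℤ} (haj : a ≤ j) (hjb : j ≤ b) :
    blkCluster ω K j (goodWitness K θ j ω) ⊆ chainCluster K θ a b ω :=
  blkCluster_subset_locCluster_of_good_chain hK hθ (x := fun j => goodWitness K θ j ω)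
    (fun _ h1 h2 => blkEdges_subset_chainEdges h1 h2) (fun _ h1 h2 => blk_subset_chainSites h1 h2)
    (fun j h1 h2 => (goodWitness_spec (hgood j h1 h2)).2) (Reachable.refl _) haj hjb

/-- **Size of the merged cluster**: `N · 2θK ≤ #𝐂` whenever the blocks `B^{a+2m}_K`, `m < N`,
belong to the chain. [cite: DuminilcopinGarbanTassion2024, §2.3 (proof of Lemma 2, (2.4))] -/
theorem card_chainCluster_ge {K : ℕ} (hK : 1 ≤ K) {θ : ℝ} (hθ : 3 / 4 < θ)
    {a b : ℤ} {ω : BondConfig ℤ} (hgood : ∀ j, a ≤ j → j ≤ b → ω ∈ good K θ j)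
    {N : ℕ} (hN : a + 2 * ((N : ℤ) - 1) ≤ b) :
    (N : ℝ) * (2 * θ * K) ≤ ((chainCluster K θ a b ω).card : ℝ) :=
  card_locCluster_ge_of_good_chain hK hθ (x := fun j => goodWitness K θ j ω)
    (fun _ h1 h2 => blkEdges_subset_chainEdges h1 h2) (fun _ h1 h2 => blk_subset_chainSites h1 h2)
    (fun j h1 h2 => (goodWitness_spec (hgood j h1 h2)).2) (Reachable.refl _) hN

/-- **A run of good blocks makes the big block good.** If the blocks `B^j_K`, `a ≤ j ≤ b`, all
inside `B_{CK}`, are `θ`-good and `N` of them have pairwise index distance `2`, then `B_{CK}` is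
`θ'`-good for every `θ'` with `2θ'CK ≤ N · 2θK`.
[cite: DuminilcopinGarbanTassion2024, §2.3 (proof of Lemma 2, "the existence of a cluster in B_{CK} with cardinality larger than 2θCK")] -/
theorem good_mul_of_good_chain {K : ℕ} (hK : 1 ≤ K) {θ θ' : ℝ} (hθ : 3 / 4 < θ) {C : ℕ}
    {a b : ℤ} (ha : -(C : ℤ) + 1 ≤ a) (hb : b ≤ (C : ℤ) - 1) (hab : a ≤ b) {ω : BondConfig ℤ}
    (hgood : ∀ j, a ≤ j → j ≤ b → ω ∈ good K θ j) {N : ℕ} (hN : a + 2 * ((N : ℤ) - 1) ≤ b)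
    (hθ' : 2 * θ' * ↑(C * K) ≤ (N : ℝ) * (2 * θ * K)) : ω ∈ good (C * K) θ' 0 := by
  refine ⟨goodWitness K θ a ω,
    blk_subset_blk_mul ha (by linarith) (goodWitness_spec (hgood a le_rfl hab)).1,
    hθ'.trans ((card_chainCluster_ge hK hθ hgood hN).trans ?_)⟩
  exact_mod_cast Finset.card_le_card (locCluster_mono subset_rfl
    (chainEdges_subset_blkEdges_mul ha hb) (chainSites_subset_blk_mul ha hb) _)

/-! ### The events of the proof of Lemma 2 and the covering lemma -/

/-- **Two disjoint bad blocks**: there are `θ`-bad blocks `B^j_K`, `B^{j'}_K ⊆ B_{CK}` with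
`j + 2 ≤ j'` (disjoint blocks). [cite: DuminilcopinGarbanTassion2024, §2.3 (proof of Lemma 2, (2.4)–(2.5))] -/
def twoBad (K : ℕ) (θ : ℝ) (C : ℕ) : Set (BondConfig ℤ) :=
  {ω | ∃ j j' : ℤ, -(C : ℤ) + 1 ≤ j ∧ j + 2 ≤ j' ∧ j' ≤ (C : ℤ) - 1 ∧ ω ∈ bad K θ j ∧ ω ∈ bad K θ j'}

/-- **DGT's event `E_i`**: `B^i_K` is `θ`-bad and all the blocks `B^j_K ⊆ B_{CK}` with
`j ∉ {i-1, i, i+1}` are `θ`-good. [cite: DuminilcopinGarbanTassion2024, §2.3 (proof of Lemma 2, E_i)] -/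
def isolBad (K : ℕ) (θ : ℝ) (C : ℕ) (i : ℤ) : Set (BondConfig ℤ) :=
  bad K θ i ∩ {ω | ∀ j : ℤ, -(C : ℤ) + 1 ≤ j → j ≤ (C : ℤ) - 1 → (j + 2 ≤ i ∨ i + 2 ≤ j) →
    ω ∈ good K θ j}

/-- **Covering lemma** (DGT, proof of Lemma 2: "if `B_{CK}` is `θ'`-bad, then either there exist
(at least) two disjoint `θ`-bad `K`-blocks, or there exists `i` such that `F_i` occurs", with
`F_i = E_i ∩ {B_{CK} is θ'-bad}`, and "`F_i = ∅` whenever `|i| > C - C₀`"), for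
`θ' = θ - C₀/C`, `3/4 < θ ≤ 1`, `C₀ ≤ C`: if no two disjoint blocks are bad, the bad blocks are
`B^i_K` and possibly `B^{i+1}_K` for the smallest bad index `i`; if `|i| > C - C₀` the `C - C₀`
disjoint good blocks on the far side of `i` already give a cluster of size
`≥ (C - C₀) 2θK ≥ 2θ'CK`. [cite: DuminilcopinGarbanTassion2024, §2.3 (proof of Lemma 2, (2.4))] -/
theorem bad_mul_subset {K : ℕ} (hK : 1 ≤ K) {θ : ℝ} (hθ : 3 / 4 < θ) (hθ1 : θ ≤ 1) {C C₀ : ℕ}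
    (hC₀C : C₀ ≤ C) (hC : 1 ≤ C) :
    bad (C * K) (θ - C₀ / C) 0 ⊆ twoBad K θ C ∪
      ⋃ i ∈ Finset.Icc (-((C : ℤ) - C₀)) ((C : ℤ) - C₀), (isolBad K θ C i ∩ bad (C * K) (θ - C₀ / C) 0) := by
  intro ω hbad
  have hCpos : (0 : ℝ) < C := by exact_mod_cast hC
  have hK0 : (0 : ℝ) ≤ K := Nat.cast_nonneg K
  have hθK : 0 ≤ 2 * θ * K := by nlinarith
  -- the big block is not `θ'`-good; a full run of good blocks would make it good
  have key : ∀ {a b : ℤ} (N : ℕ), -(C : ℤ) + 1 ≤ a → b ≤ (C : ℤ) - 1 → a ≤ b →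
      (∀ j, a ≤ j → j ≤ b → ω ∈ good K θ j) → a + 2 * ((N : ℤ) - 1) ≤ b →
      ((C : ℝ) - C₀) ≤ N → False := by
    intro a b N ha hb hab hgood hN hNC
    refine hbad (good_mul_of_good_chain hK hθ ha hb hab hgood hN ?_)
    have e1 : 2 * (θ - C₀ / C) * ((C * K : ℕ) : ℝ) = (C - C₀) * (2 * θ * K) - C₀ * (1 - θ) * (2 * K) := by
      push_cast; field_simp; ring
    rw [e1]
    have h2 : ((C : ℝ) - C₀) * (2 * θ * K) ≤ N * (2 * θ * K) := mul_le_mul_of_nonneg_right hNC hθK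
    have hC₀0 : (0 : ℝ) ≤ C₀ := Nat.cast_nonneg C₀
    nlinarith [mul_nonneg (mul_nonneg hC₀0 (sub_nonneg.2 hθ1)) hK0]
  by_cases hall : ∀ j : ℤ, -(C : ℤ) + 1 ≤ j → j ≤ (C : ℤ) - 1 → ω ∈ good K θ j
  · exact (key C (le_refl _) (le_refl _) (by omega) hall (by linarith)
      (by linarith [(Nat.cast_nonneg C₀ : (0 : ℝ) ≤ C₀)])).elim
  push Not at hall
  -- the smallest bad index
  set Bad : Finset ℤ := (Finset.Icc (-(C : ℤ) + 1) ((C : ℤ) - 1)).filter fun j => ω ∈ bad K θ j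
    with hBad
  have hBadne : Bad.Nonempty := by
    obtain ⟨j, hj1, hj2, hj⟩ := hall
    exact ⟨j, Finset.mem_filter.2 ⟨Finset.mem_Icc.2 ⟨hj1, hj2⟩, hj⟩⟩
  set i := Bad.min' hBadne with hi
  have hiBad : i ∈ Bad := Finset.min'_mem _ _
  obtain ⟨hiI, hibad⟩ := Finset.mem_filter.1 hiBad
  rw [Finset.mem_Icc] at hiI
  have hmin : ∀ j : ℤ, -(C : ℤ) + 1 ≤ j → j ≤ (C : ℤ) - 1 → j < i → ω ∈ good K θ j := by
    intro j hj1 hj2 hji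
    by_contra hj
    have : i ≤ j := Finset.min'_le _ _ (Finset.mem_filter.2 ⟨Finset.mem_Icc.2 ⟨hj1, hj2⟩, hj⟩)
    exact absurd hji (not_lt.2 this)
  by_cases htwo : ∃ j' : ℤ, i + 2 ≤ j' ∧ j' ≤ (C : ℤ) - 1 ∧ ω ∈ bad K θ j'
  · obtain ⟨j', h1, h2, h3⟩ := htwo
    exact Or.inl ⟨i, j', hiI.1, h1, h2, hibad, h3⟩
  push Not at htwo
  have hright : ∀ j : ℤ, i + 2 ≤ j → j ≤ (C : ℤ) - 1 → ω ∈ good K θ j := fun j h1 h2 =>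
    Set.not_notMem.1 (htwo j h1 h2)
  by_cases hiC : -((C : ℤ) - C₀) ≤ i ∧ i ≤ (C : ℤ) - C₀
  · refine Or.inr (Set.mem_iUnion₂.2 ⟨i, Finset.mem_Icc.2 hiC, ⟨hibad, ?_⟩, hbad⟩)
    intro j hj1 hj2 hj
    rcases hj with hj | hj
    · exact hmin j hj1 hj2 (by linarith)
    · exact hright j hj hj2
  · exfalso
    rw [not_and_or, not_le, not_le] at hiC
    have hcast : (((C - C₀ : ℕ) : ℤ)) = (C : ℤ) - C₀ := by push_cast [Nat.cast_sub hC₀C]; ring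
    have hcastR : ((C : ℝ) - C₀) ≤ ((C - C₀ : ℕ) : ℝ) := by push_cast [Nat.cast_sub hC₀C]; rfl
    rcases hiC with hiC | hiC
    · -- `i < -(C - C₀)`: the blocks `j ≥ -C + C₀ + 1 ≥ i + 2` are all good
      refine key (a := -(C : ℤ) + C₀ + 1) (b := (C : ℤ) - 1) (C - C₀) (by omega) le_rfl (by omega)
        (fun j hj1 hj2 => hright j (by omega) hj2) ?_ hcastR
      rw [hcast]; omega
    · -- `C - C₀ < i`: the blocks `j ≤ C - C₀ - 1 ≤ i - 2` are all good
      refine key (a := -(C : ℤ) + 1) (b := (C : ℤ) - C₀ - 1) (C - C₀) le_rfl (by omega) (by omega)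
        (fun j hj1 hj2 => hmin j hj1 (by omega) (by omega)) ?_ hcastR
      rw [hcast]; omega

/-- **On `F_i` no open edge joins `𝐂⁻` to `𝐂⁺`** (DGT: "if `B_{CK}` is `θ'`-bad, then `𝐂⁻` and
`𝐂⁺` cannot be connected together"): for `3 ≤ C₀`, `|i| ≤ C - C₀`, `θ' = θ - C₀/C`, on
`E_i ∩ {B_{CK} is θ'-bad}` every edge from `𝐂⁻ = chainCluster (-C+1) (i-2)` to
`𝐂⁺ = chainCluster (i+2) (C-1)` is closed — otherwise `𝐂⁻ ∪ 𝐂⁺` would lie in one cluster of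
`B_{CK}` of size `≥ (C - 2) 2θK ≥ 2θ'CK`.
[cite: DuminilcopinGarbanTassion2024, §2.3 (proof of Lemma 2)] -/
theorem forall_not_mem_of_isolBad {K : ℕ} (hK : 1 ≤ K) {θ : ℝ} (hθ : 3 / 4 < θ) (hθ1 : θ ≤ 1)
    {C C₀ : ℕ} (hC₀ : 3 ≤ C₀) {i : ℤ} (hi1 : -((C : ℤ) - C₀) ≤ i) (hi2 : i ≤ (C : ℤ) - C₀)
    {ω : BondConfig ℤ} (hE : ω ∈ isolBad K θ C i) (hbad : ω ∈ bad (C * K) (θ - C₀ / C) 0) :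
    ∀ u ∈ chainCluster K θ (-(C : ℤ) + 1) (i - 2) ω, ∀ v ∈ chainCluster K θ (i + 2) ((C : ℤ) - 1) ω,
      s(u, v) ∉ ω := by
  intro u hu v hv huv
  obtain ⟨-, hgood⟩ := hE
  have hgoodL : ∀ j, -(C : ℤ) + 1 ≤ j → j ≤ i - 2 → ω ∈ good K θ j :=
    fun j h1 h2 => hgood j h1 (by omega) (Or.inl (by omega))
  have hgoodR : ∀ j, i + 2 ≤ j → j ≤ (C : ℤ) - 1 → ω ∈ good K θ j :=
    fun j h1 h2 => hgood j (by omega) h2 (Or.inr h1)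
  set w := goodWitness K θ (-(C : ℤ) + 1) ω with hw
  set w' := goodWitness K θ (i + 2) ω with hw'
  set G := openGraph (ω ∩ blkEdges (C * K) 0) with hG
  have hEL : chainEdges K (-(C : ℤ) + 1) (i - 2) ⊆ blkEdges (C * K) 0 :=
    chainEdges_subset_blkEdges_mul le_rfl (by omega)
  have hER : chainEdges K (i + 2) ((C : ℤ) - 1) ⊆ blkEdges (C * K) 0 :=
    chainEdges_subset_blkEdges_mul (by omega) le_rfl
  have hSL : chainSites K (-(C : ℤ) + 1) (i - 2) ⊆ blk (C * K) 0 :=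
    chainSites_subset_blk_mul le_rfl (by omega)
  have hSR : chainSites K (i + 2) ((C : ℤ) - 1) ⊆ blk (C * K) 0 :=
    chainSites_subset_blk_mul (by omega) le_rfl
  have hmonoL : openGraph (ω ∩ chainEdges K (-(C : ℤ) + 1) (i - 2)) ≤ G :=
    openGraph_mono (Set.inter_subset_inter_right _ hEL)
  have hmonoR : openGraph (ω ∩ chainEdges K (i + 2) ((C : ℤ) - 1)) ≤ G :=
    openGraph_mono (Set.inter_subset_inter_right _ hER)
  have huS := chainCluster_subset K θ _ _ ω hu
  have hvS := chainCluster_subset K θ _ _ ω hv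
  have huS' := huS; have hvS' := hvS
  rw [chainSites, Finset.mem_Ico] at huS' hvS'
  -- the open edge `{u, v}` is an edge of `G`
  have hadj : G.Adj u v := by
    rw [hG, openGraph_adj]
    exact ⟨⟨huv, mk_mem_blkEdges.2 ⟨hSL huS, hSR hvS⟩⟩,
      by intro h; subst h; nlinarith [huS'.2, hvS'.1, Int.natCast_nonneg K]⟩
  have hwu : G.Reachable w u := (reachable_of_mem_chainCluster hu).mono hmonoL
  have hw'v : G.Reachable w' v := (reachable_of_mem_chainCluster hv).mono hmonoR
  -- the block cluster of `w` in `B_{CK}` contains `𝐂⁻ ∪ 𝐂⁺`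
  have hsub : chainCluster K θ (-(C : ℤ) + 1) (i - 2) ω ∪ chainCluster K θ (i + 2) ((C : ℤ) - 1) ω ⊆
      blkCluster ω (C * K) 0 w := by
    intro z hz
    rw [mem_locCluster]
    rcases Finset.mem_union.1 hz with hz | hz
    · exact ⟨hSL (chainCluster_subset K θ _ _ ω hz), (reachable_of_mem_chainCluster hz).mono hmonoL⟩
    · exact ⟨hSR (chainCluster_subset K θ _ _ ω hz),
        ((hwu.trans hadj.reachable).trans hw'v.symm).trans ((reachable_of_mem_chainCluster hz).mono hmonoR)⟩
  have hdisj : Disjoint (chainCluster K θ (-(C : ℤ) + 1) (i - 2) ω) (chainCluster K θ (i + 2) ((C : ℤ) - 1) ω) := by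
    refine Finset.disjoint_of_subset_left (chainCluster_subset K θ _ _ ω)
      (Finset.disjoint_of_subset_right (chainCluster_subset K θ _ _ ω) ?_)
    rw [Finset.disjoint_left]
    intro z hz hz'
    rw [chainSites, Finset.mem_Ico] at hz hz'
    nlinarith [hz.2, hz'.1, Int.natCast_nonneg K]
  -- sizes of the two merged clusters
  obtain ⟨NL, NR, hNL, hNR, hsum⟩ : ∃ NL NR : ℕ, (-(C : ℤ) + 1) + 2 * ((NL : ℤ) - 1) ≤ i - 2 ∧
      (i + 2) + 2 * ((NR : ℤ) - 1) ≤ (C : ℤ) - 1 ∧ (C : ℤ) - 2 ≤ NL + NR := by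
    refine ⟨((C : ℤ) + i - 1).toNat / 2, ((C : ℤ) - i - 1).toNat / 2, ?_, ?_, ?_⟩ <;> omega
  have hcardL := card_chainCluster_ge hK hθ hgoodL hNL
  have hcardR := card_chainCluster_ge hK hθ hgoodR hNR
  refine hbad ⟨w, blk_subset_blk_mul le_rfl (by omega) (goodWitness_spec (hgoodL _ le_rfl (by omega))).1, ?_⟩
  have hcard := Finset.card_le_card hsub
  rw [Finset.card_union_of_disjoint hdisj] at hcard
  have hcard' : ((chainCluster K θ (-(C : ℤ) + 1) (i - 2) ω).card : ℝ) +
      ((chainCluster K θ (i + 2) ((C : ℤ) - 1) ω).card : ℝ) ≤ ((blkCluster ω (C * K) 0 w).card : ℝ) := by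
    exact_mod_cast hcard
  have hsumR : (C : ℝ) - 2 ≤ (NL : ℝ) + NR := by exact_mod_cast hsum
  have hCpos : (0 : ℝ) < C := by
    have : (0 : ℤ) < C := by omega
    exact_mod_cast this
  have hK0 : (0 : ℝ) ≤ K := Nat.cast_nonneg K
  have hθK : 0 ≤ 2 * θ * K := by nlinarith
  have e1 : 2 * (θ - C₀ / C) * ((C * K : ℕ) : ℝ) = (C - 2) * (2 * θ * K) - (C₀ - 2 * θ) * (2 * K) := by
    push_cast; field_simp; ring
  rw [e1]
  have h2 : ((C : ℝ) - 2) * (2 * θ * K) ≤ ((NL : ℝ) + NR) * (2 * θ * K) := mul_le_mul_of_nonneg_right hsumR hθK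
  have hC₀3 : (3 : ℝ) ≤ C₀ := by exact_mod_cast hC₀
  nlinarith [mul_nonneg (show (0 : ℝ) ≤ C₀ - 2 * θ by linarith) hK0]

/-! ### Locality of the events -/

/-- `E_i` is determined by the edges inside the blocks `B^j_K ⊆ B_{CK}`.
[cite: DuminilcopinGarbanTassion2024, §2.3 (proof of Lemma 2, conditioning)] -/
theorem determinedBy_isolBad (K : ℕ) (θ : ℝ) (C : ℕ) {i : ℤ} (hi1 : -(C : ℤ) + 1 ≤ i)
    (hi2 : i ≤ (C : ℤ) - 1) :
    DeterminedBy (isolBad K θ C i) (chainEdges K (-(C : ℤ) + 1) ((C : ℤ) - 1)) := by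
  rw [determinedBy_iff]
  intro ω ω' h
  have hblk : ∀ j, -(C : ℤ) + 1 ≤ j → j ≤ (C : ℤ) - 1 → (ω ∈ good K θ j ↔ ω' ∈ good K θ j) := by
    intro j hj1 hj2
    have hsub := blkEdges_subset_chainEdges (K := K) hj1 hj2
    rw [← good_inter_eq hsub ω, ← good_inter_eq hsub ω', h]
  simp only [isolBad, bad, Set.mem_inter_iff, Set.mem_compl_iff, Set.mem_setOf_eq]
  rw [hblk i hi1 hi2]
  constructor <;> rintro ⟨h1, h2⟩ <;> refine ⟨h1, fun j hj1 hj2 hj => ?_⟩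
  · exact (hblk j hj1 hj2).1 (h2 j hj1 hj2 hj)
  · exact (hblk j hj1 hj2).2 (h2 j hj1 hj2 hj)

/-- `E_i` is measurable. [folklore] -/
theorem measurableSet_isolBad (K : ℕ) (θ : ℝ) (C : ℕ) {i : ℤ} (hi1 : -(C : ℤ) + 1 ≤ i)
    (hi2 : i ≤ (C : ℤ) - 1) : MeasurableSet (isolBad K θ C i) := by
  have h := determinedBy_isolBad K θ C hi1 hi2
  rw [← (chainEdges_finite K _ _).coe_toFinset] at h
  exact h.measurableSet_of_finset

/-- If `A` is determined by `E` and the statistic `Ψ` only reads the coordinates in `E`, then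
every event `A ∩ {Ψ = b}` is determined by `E` (the shape of hypothesis consumed by the
conditional-independence decomposition). [folklore] -/
theorem DeterminedBy.inter_preimage_singleton {ι β : Type*} {A : Set (Set ι)} {E : Set ι}
    (hA : DeterminedBy A E) {Ψ : Set ι → β} (hΨ : ∀ ω, Ψ (ω ∩ E) = Ψ ω) (b : β) :
    DeterminedBy (A ∩ Ψ ⁻¹' {b}) E := by
  rw [determinedBy_iff] at hA ⊢
  intro ω ω' h
  rw [Set.mem_inter_iff, Set.mem_inter_iff, hA ω ω' h, Set.mem_preimage, Set.mem_preimage,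
    ← hΨ ω, ← hΨ ω', h]

/-- The pair `(𝐂⁻, 𝐂⁺)` only reads the edges inside the blocks `B^j_K ⊆ B_{CK}`.
[cite: DuminilcopinGarbanTassion2024, §2.3 (proof of Lemma 2, "involves only edges with endpoints within a distance 2K")] -/
theorem chainCluster_pair_inter_eq {K : ℕ} {θ : ℝ} {C : ℕ} {i : ℤ} (hi1 : -(C : ℤ) + 3 ≤ i)
    (hi2 : i ≤ (C : ℤ) - 3) (ω : BondConfig ℤ) :
    (chainCluster K θ (-(C : ℤ) + 1) (i - 2) (ω ∩ chainEdges K (-(C : ℤ) + 1) ((C : ℤ) - 1)),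
      chainCluster K θ (i + 2) ((C : ℤ) - 1) (ω ∩ chainEdges K (-(C : ℤ) + 1) ((C : ℤ) - 1))) =
    (chainCluster K θ (-(C : ℤ) + 1) (i - 2) ω, chainCluster K θ (i + 2) ((C : ℤ) - 1) ω) := by
  rw [chainCluster_inter_eq (by omega) (chainEdges_mono le_rfl (by omega)),
    chainCluster_inter_eq (by omega) (chainEdges_mono (by omega) le_rfl)]

end Literature.Probability.Percolation

end
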